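import Mathlib
import HarnessLib
import Summits.BirchSwinnertonDyer.BirchSwinnertonDyer.Theses.ManinLocalTwoThree
import Summits.BirchSwinnertonDyer.BirchSwinnertonDyer.Theorems.ManinLocalTwoThreeCDivisionIntegralCDT
import Literature.NumberTheory.Automorphic.UnboundedDenominators

/-!
# Lines/cdivision_udc_int_candidate.lean — (p2 gen 21 for the C3 chain, 2026-08-30): C3 `ManinPrimeToThreeAtNine` ⟸ CDT THEOREM 1 VERBATIM (ℤ-coefficients).
# Same line as `Lines/cdivision_udc.lean` v1 (p3 g18; ONE printed stub), with the stub WEAKENED from the Remark-58/59 generalisation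
# `CalegariDimitrovTang2025_unboundedDenominators_algInt` to the paper's Theorem 1 as printed, `CalegariDimitrovTang2025_unboundedDenominators`
# (`f ∈ ℤ⟦q^{1/N}⟧`): the `c`-division witness `F = 12·℘_{Λ_W}(ℰ_f)·G·Δ^a` has RATIONAL-INTEGER `q`-coefficients (Honda at the multiplier `1`), kernel theorem
# `CDivisionInt.exists_cDivisionWitnessInt`; composition `CDivisionInt.maninPrimeToThreeAtNine_of_CDTInt`.  The old stub implies the new one
# (`Literature.NumberTheory.Automorphic.CalegariDimitrovTang2025_unboundedDenominators_of_algInt`).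
# HONEST FRAMING: CONDITIONAL reduction — C3 holds modulo the printed Theorem 1 of Calegari–Dimitrov–Tang (J. Amer. Math. Soc. 38 (2025)), which is NOT proved in
# the tree; BSD is not proved; Manin's conjecture at 3 is not proved unconditionally.
-/

set_option autoImplicit false
set_option linter.dupNamespace false

noncomputable section

namespace Summit.BirchSwinnertonDyer.BirchSwinnertonDyer.Cruxes.ManinPrimeToThreeAtNine.CDivisionUDCInt

/-- STUB (PRINTED) CDT Theorem 1 — Calegari–Dimitrov–Tang 2025, Thm. 1.0.1 VERBATIM (Unbounded Denominators: a modular form of integral weight on a finite-index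
subgroup of `SL₂(ℤ)` with rational-INTEGER Fourier coefficients at `i∞` is modular for a congruence subgroup), holomorphic-at-the-cusps special case, the vendored
statement-only fact `Literature.NumberTheory.Automorphic.CalegariDimitrovTang2025_unboundedDenominators`; CITE-ONLY.  (Remarks 58–59 are NOT needed.)
[cite: CalegariDimitrovTang2025, Thm. 1.0.1] -/
theorem stub_CDT : Literature.NumberTheory.Automorphic.CalegariDimitrovTang2025_unboundedDenominators := by
  sorry

/-- COMPOSITION (no sorry): `CDivisionInt.maninPrimeToThreeAtNine_of_CDTInt` (p2 g21; integer witness + p2 g17 `UDWOfCDT.unboundedDenominatorsWeight_of_CDT`). -/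
theorem ManinPrimeToThreeAtNine_of :
    Summit.BirchSwinnertonDyer.BirchSwinnertonDyer.Theses.ManinLocalTwoThree.ManinPrimeToThreeAtNine :=
  Summit.BirchSwinnertonDyer.BirchSwinnertonDyer.Theorems.ManinLocalTwoThree.CDivisionInt.maninPrimeToThreeAtNine_of_CDTInt stub_CDT

end Summit.BirchSwinnertonDyer.BirchSwinnertonDyer.Cruxes.ManinPrimeToThreeAtNine.CDivisionUDCInt

end
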